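/-
Copyright (c) 2026 the pub-hodgecm2 formalisation cell (harness21).  New file.
Origin: seat `prover-pub-hodgecm-own-htheta-g10-0` (unit pub-hodgecm-own-htheta, gen 10; OWNER of the item-(vi) lineage, S2-CRUX owner, X3 co-owner,
Δ2-bridge consultant for the δ′ row), 2026-08-23 — Δ2 BRIDGE §3 R2 L2.1 AT THE MODEL, δ′-GENERIC (assembler DECISION #7 (1)∕(7)): the μ-UNIFORM
presentation `Model.uniformOmegaRep … δ′ r` of the model's Def. 4.11 Weil carriers at an explicit ε-normaliser `δ′` and representative section `r`
(`UniformOmega`, ✔ `Liu2021/AppendixC/Prop413DataOfTower.lean`), whose rests ARE item6-p3's generic Liu rests `Model.restOfCharRep … δ′ r μ hμ hw`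
(`Transposition/Item6RestOfCharRep.lean`) BY `rfl`, so that the Δ2 junctions' multiplicity pin `hmultD` at `restOfCharRep … δ′ r` — in particular at
Liu's token `δ′ = (2δ_F)⁻¹` — is DERIVED from the LITERAL cite `Prop413AsPrinted ((uniformOmegaRep … δ′ r).prop413Data H)` of [Liu2021, Prop. 4.13]
AS PRINTED; at `δ′ := δ_F`, `r := Rep.ofLineOf` the same for `restOfCharD`.  KERNEL only (one data `def` assembling a record + theorems); count-neutral;
no pointer moves; nothing landed is edited.  HC_CM is NOT proved; «Δ2 BRIDGE CLOSED» is NOT claimed.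
-/
import Summits.HodgeConjecture.CorCM.B01.Transposition.Item6RestOfCharRep
import Literature.NumberTheory.Automorphic.Liu2021.AppendixC.Prop413DataOfRestOne
import HarnessLib

set_option autoImplicit false

/-!
# The μ-uniform Weil carriers of the model at `(δ′, r)` and the multiplicity pin at `restOfCharRep` from [Liu2021, Prop. 4.13] AS PRINTED

Parameters exactly those of `Model.restOfCharRep` before `μ`: `F/ℚ` Galois, a face datum `(ι₁, V, Φ)`, a real non-degenerate diagonal frame
`(e, dV)` with `ιV : (sec42DataOf …).G →* U(diag dV)(𝔸_{F⁺,f})`, the ε-normaliser `δ′ : F` and a family `r μ hμ` of representative sections of the collections, ONE PER conjugate-symplectic `μ` (assembler∕prove-6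
(R-unif): the pin re-points the section at the line(s) of record carrying `μ`; a constant family is the special case).

* `Model.uniformOmegaRep h F ι₁ V Φ e dV hdV hdV0 ιV δ′ r : UniformOmega (sec42DataOf h isoOf F ι₁ V Φ)` — `Eps`, `epsOf … δ′`, `Chi` and, for
  EVERY conjugate-symplectic `μ`, `ω(μ,ε,χ) := omegaAtLine … (hsChiD … (toHeckeCharacter F μ) …) (r μ hμ ε) χ` with its action `rhoAtLine … ιV (r μ hμ ε) χ`
  — verbatim the carrier terms of `restOfCharRep`;
* `Model.restOfCharRep_eq_rest` — `restOfCharRep … δ′ (r μ hμ) μ hμ hw = (uniformOmegaRep … δ′ r).rest (restTailOne (AlgHom.id ℚ F) ι₁ hμ hw (Carriers.ofPolDR …) (rhoΩOne …))`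
  (`rfl`: FIELDS MATCH; `restTailOne` = ✔ `AppendixC/Prop413DataOfRestOne.lean`);
* `Model.restOfCharD_eq_rest` — the same for `restOfCharD` at `δ′ := imagUnit F`, `r := Rep.ofLineOf` (`rfl`, via `restOfCharRep_ofLineOf`);
* `Model.rank_intertwiningMap_rhoAt_restOfCharRep_le_one_of_prop413AsPrinted` — THE PAY-OFF at the model: for every `ℂ[𝔾(𝔸_F^∞)]`-module `H`
  (the consumer's tower for `H¹_{B,ι₁}(A_∞, ℂ)`), `Prop413AsPrinted ((uniformOmegaRep … δ′ r).prop413Data H)` + `3 ≤ n` + Def. 4.11 adjectives +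
  pairwise non-isomorphy + `∃ K` compact open ⟹ `dim_ℂ Hom_{ℂ[𝔾(𝔸_F^∞)]}(ω_i, H) ≤ 1` for every admissible index `i` of
  `toThm418Data (sec42DataOf …) (restOfCharRep … δ′ r μ hμ hw)` at EVERY conjugate-symplectic weight-one `μ` — the junctions' `hmultD μ hμ hg i`
  at `R μ hμ hg := restOfCharRep … δ′ r μ hμ (hw μ hg)` (assembler (d′): `R₀ := restOfCharDeltaPrime`, `δ′ := (2·δ_F)⁻¹`), no proof-sentence cite,
  no `hirrD ∕ hnvD`; and `…_restOfCharD_…` likewise.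

## References
* [Liu2021] Y. Liu, *Fourier–Jacobi cycles and arithmetic relative trace formula*, Camb. J. Math. 9 (2021) 1–147 = arXiv:2102.11518 —
  Prop. 4.13 (FJcycle.tex ll. 2113–2119), Def. 4.11 (ll. 2083–2097), Def. 4.12 (ll. 2102–2108), Def. 4.16, Thm. 4.18 (2), App. D Lem. D.1 (3).
* [GelbartRogawski1991] S. Gelbart, J. Rogawski, *L-functions and Fourier–Jacobi coefficients for the unitary group U(3)*, Invent. Math. 105
  (1991), §3.1 Prop. 3.1.1 p. 455.
* Tree: `Transposition/Item6RestOfCharRep.lean` (`restOfCharRep`, `restOfCharRep_ofLineOf`), `Transposition/Item6RestOfChar.lean` (`restOfCharD`),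
  `Liu2021/Def411WeilCarriersAtLine.lean` (`Rep`, `omegaAtLine`, `rhoAtLine`), `AppendixC/Prop413DataOfTower.lean` (`UniformOmega`),
  `AppendixC/Prop413DataOfRestOne.lean` (`restTailOne`, `UniformOmega.rank_intertwiningMap_rhoAt_restOne_le_one_of_prop413AsPrinted`).

HC_CM is NOT proved.
-/

noncomputable section

namespace Summit.HodgeConjecture.CorCM.Model

open NumberField
open Literature.AlgebraicGeometry.Motives
open Literature.AlgebraicGeometry.ShimuraVarieties.UnitaryCanonicalModel
open Literature.NumberTheory.Automorphic
open Literature.NumberTheory.Automorphic.IdeleClassGroup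
open Literature.NumberTheory.Automorphic.Liu2021
open Literature.NumberTheory.Automorphic.Liu2021.AppendixC
open Literature.NumberTheory.Automorphic.Liu2021.AppendixC.RestOne
open Literature.NumberTheory.Automorphic.Liu2021.Def411WeilCarriers (Rep omegaAtLine rhoAtLine)
open Literature.NumberTheory.GelbartRogawski1991 Literature.NumberTheory.GelbartRogawski1991.UnitaryDualPair
open Literature.NumberTheory.GelbartRogawski1991.UnitaryDualPair.WeilCoinv
open Literature.NumberTheory.Weil1964 Literature.RepresentationTheory
open Literature.RepresentationTheory.Liu2021
open Summit.HodgeConjecture.CorCM.Transposition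

section Frame

variable (h : exists_recordSystem) (F : CMField) [IsGalois ℚ F]
  (ι₁ : F →+* ℂ) (V : HermSpace3 F ι₁) (Φ : CMType F) {n : ℕ} (e : Fin 3 × Fin 1 ≃ Fin n) (dV : Fin 3 → F)
  (hdV : ∀ i, IsCMField.complexConj F (dV i) = dV i) (hdV0 : ∀ i, dV i ≠ 0)
  (ιV : (sec42DataOf h isoOf F ι₁ V Φ).G →*
    UnitaryGroup.finAdelic ↥(maximalRealSubfield F) F (IsCMField.complexConj F) 3 (Matrix.diagonal dV))
  (δ' : F) (r : ∀ μ : IdeleClassGroup F →ₜ* Circle,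
    IdeleClassGroup.IsConjugateSymplectic F μ → Rep ↥(maximalRealSubfield F) (imagUnitSq F))

/-- **The μ-UNIFORM Weil carriers of the model at `(δ′, r)`**: [Liu2021, Def. 4.11 ∕ 4.12]'s `Eps`, `epsOf … δ′` (the collection of `e` read as
the local classes of `e/δ′`), `Chi` and, for EVERY conjugate-symplectic `μ`, `ω(μ,ε,χ)` realised on the line `⟨r μ hμ ε⟩` (the `μ`-th section) at the splitting family
attached to `μ` (`OmegaChiSplitting.hsChiD … (toHeckeCharacter F μ)`, [GR91] Prop. 3.1.1) with its `𝔾(𝔸_F^∞)`-action through `ιV` — verbatim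
the carrier terms of `restOfCharRep … δ′ (r μ hμ)`.  Nothing asserted.
[cite: Liu2021, Def. 4.11 (ll. 2083–2097), Def. 4.12 (ll. 2102–2108)] [cite: GelbartRogawski1991, §3.1 Prop. 3.1.1 p. 455 L1–3] -/
def uniformOmegaRep : UniformOmega (sec42DataOf h isoOf F ι₁ V Φ) where
  Eps := Def411WeilCarriers.Eps ↥(maximalRealSubfield F) (imagUnitSq F)
  epsOf := Def411WeilCarriers.epsOf ↥(maximalRealSubfield F) (imagUnitSq F) F δ'
  Chi := Def411WeilCarriers.Chi ↥(maximalRealSubfield F) F (IsCMField.complexConj F)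
  omega μ hμ ε χ :=
    omegaAtLine ↥(maximalRealSubfield F) F (IsCMField.complexConj F) 3 e (Matrix.diagonal dV)
      (complexConj_imagUnit F) (imagUnit_ne_zero F) (imagUnit_mul_self F) (realDiagonal_isSymm F dV hdV)
      (isUnit_det_realDiagonal F dV hdV hdV0) (realDiagonal_map F dV hdV).symm
      (OmegaChiSplitting.hsChiD F e dV hdV hdV0 (toHeckeCharacter F μ) (isUnitary_toHeckeCharacter F μ)
        ((isOscillatorChar_toHeckeCharacter_iff μ).mpr hμ)) ((r μ hμ).toFun ε) χ
  rho μ hμ ε χ :=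
    rhoAtLine ↥(maximalRealSubfield F) F (IsCMField.complexConj F) 3 e (Matrix.diagonal dV)
      (complexConj_imagUnit F) (imagUnit_ne_zero F) (imagUnit_mul_self F) (realDiagonal_isSymm F dV hdV)
      (isUnit_det_realDiagonal F dV hdV hdV0) (realDiagonal_map F dV hdV).symm
      (OmegaChiSplitting.hsChiD F e dV hdV hdV0 (toHeckeCharacter F μ) (isUnitary_toHeckeCharacter F μ)
        ((isOscillatorChar_toHeckeCharacter_iff μ).mpr hμ)) ιV ((r μ hμ).toFun ε) χ

set_option maxHeartbeats 1000000 in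
-- (both sides are the same `Thm418Rest.mk` application; the ω-arguments carry the `splittingDatum` telescope of `restOfCharRep`)
/-- **FIELDS MATCH at `(δ′, r)`** — `restOfCharRep … δ′ (r μ hμ) μ hμ hw` IS the rest assembled from `uniformOmegaRep … δ′ r` and the one-object tail
`restTailOne …` (✔ `AppendixC/Prop413DataOfRestOne.lean`), by `rfl`. [cite: Liu2021, Def. 4.11, Def. 4.16, Thm. 4.18] -/
theorem restOfCharRep_eq_rest (h6 : 6 ≤ Module.finrank ℚ F) (μ : IdeleClassGroup F →ₜ* Circle)
    (hμ : IdeleClassGroup.IsConjugateSymplectic F μ) (hw : IdeleClassGroup.HasWeight F μ 1) :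
    restOfCharRep h F h6 ι₁ V Φ e dV hdV hdV0 ιV δ' (r μ hμ) μ hμ hw =
      (uniformOmegaRep h F ι₁ V Φ e dV hdV hdV0 ιV δ' r).rest
        (restTailOne (AlgHom.id ℚ F) ι₁ hμ hw (Def45.Carriers.ofPolDR μ (Def45.PolDR ι₁ hμ (Def45.RMuForm ι₁ hμ)))
          ((heckeTranslatesFamilyOf heckeTranslate_definedOver_holds h isoOf F ι₁ V Φ h6).rhoΩOne (AlgHom.id ℚ F) ι₁ hμ hw
            (Def45.Carriers.ofPolDR μ (Def45.PolDR ι₁ hμ (Def45.RMuForm ι₁ hμ))))) :=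
  rfl

set_option maxHeartbeats 1000000 in
-- (as above, through `restOfCharRep_ofLineOf`)
/-- **FIELDS MATCH for the display rest** — `restOfCharD … μ hμ hw` IS the rest assembled from `uniformOmegaRep … (imagUnit F) Rep.ofLineOf` and
the one-object tail, by `rfl` (`restOfCharRep_ofLineOf`). [cite: Liu2021, Def. 4.11, Def. 4.16, Thm. 4.18] -/
theorem restOfCharD_eq_rest (h6 : 6 ≤ Module.finrank ℚ F) (μ : IdeleClassGroup F →ₜ* Circle)
    (hμ : IdeleClassGroup.IsConjugateSymplectic F μ) (hw : IdeleClassGroup.HasWeight F μ 1) :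
    restOfCharD h F h6 ι₁ V Φ e dV hdV hdV0 ιV μ hμ hw =
      (uniformOmegaRep h F ι₁ V Φ e dV hdV hdV0 ιV (imagUnit F)
          (fun _ _ => Rep.ofLineOf ↥(maximalRealSubfield F) (imagUnitSq F))).rest
        (restTailOne (AlgHom.id ℚ F) ι₁ hμ hw (Def45.Carriers.ofPolDR μ (Def45.PolDR ι₁ hμ (Def45.RMuForm ι₁ hμ)))
          ((heckeTranslatesFamilyOf heckeTranslate_definedOver_holds h isoOf F ι₁ V Φ h6).rhoΩOne (AlgHom.id ℚ F) ι₁ hμ hw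
            (Def45.Carriers.ofPolDR μ (Def45.PolDR ι₁ hμ (Def45.RMuForm ι₁ hμ))))) :=
  rfl

set_option maxHeartbeats 1000000 in
-- (one application of the one-object pay-off; `restOfCharRep` unfolds to the `restOne` it is)
/-- **THE MULTIPLICITY PIN `hmultD` AT THE MODEL'S GENERIC RESTS `restOfCharRep … δ′ r`, from [Liu2021, Prop. 4.13] AS PRINTED.**  For every
`ℂ[𝔾(𝔸_F^∞)]`-module `H` (the consumer's tower for `H¹_{B,ι₁}(A_∞, ℂ)`): the LITERAL cite
`h413 : Prop413AsPrinted ((uniformOmegaRep … δ′ r).prop413Data H)` («there is an isomorphism `H ≃ ⊕_{(μ,ε,χ)} ω(μ,ε,χ)` of `ℂ[𝔾(𝔸_F^∞)]`-modules over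
all adèlic oscillator triples with `μ` of weight one and `ε` μ-admissible», ll. 2113–2119, read at `ι₁`), `3 ≤ n`, Def. 4.11's adjectives of the
summands (`h411`), their pairwise non-isomorphy (`hsep`: Thm. 4.18 (2) ∕ App. D Lem. D.1 (3)) and one compact open subgroup (`hK`) give
`dim_ℂ Hom_{ℂ[𝔾(𝔸_F^∞)]}(ω_i, H) ≤ 1` for every admissible index `i` of `toThm418Data (sec42DataOf …) (restOfCharRep … δ′ (r μ hμ) μ hμ hw)` at EVERY
conjugate-symplectic weight-one `μ` — the Δ2 junctions' binder `hmultD`, by Schur's lemma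
(`UniformOmega.rank_intertwiningMap_rhoAt_restOne_le_one_of_prop413AsPrinted`).
[cite: Liu2021, Prop. 4.13 (ll. 2113–2119); Def. 4.11; Thm. 4.18 (2); App. D Lemma D.1 (3)] -/
theorem rank_intertwiningMap_rhoAt_restOfCharRep_le_one_of_prop413AsPrinted (h6 : 6 ≤ Module.finrank ℚ F)
    (H : Type) [AddCommGroup H] [Module ℂ H] [Module (MonoidAlgebra ℂ (sec42DataOf h isoOf F ι₁ V Φ).G) H]
    [IsScalarTower ℂ (MonoidAlgebra ℂ (sec42DataOf h isoOf F ι₁ V Φ).G) H]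
    (h413 : Prop413AsPrinted ((uniformOmegaRep h F ι₁ V Φ e dV hdV hdV0 ιV δ' r).prop413Data H))
    (hn : 3 ≤ (honestP5Of h F ι₁ V Φ).n) (τ' : F →+* ℂ)
    (h411 : ∀ t : ((uniformOmegaRep h F ι₁ V Φ e dV hdV hdV0 ιV δ' r).prop413Data H).AdmTriple,
      IsIrreducibleOrZero (((uniformOmegaRep h F ι₁ V Φ e dV hdV hdV0 ιV δ' r).prop413Data H).rhoAt t) ∧
      IsSmoothRep (((uniformOmegaRep h F ι₁ V Φ e dV hdV hdV0 ιV δ' r).prop413Data H).rhoAt t) ∧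
      IsAdmissibleRep (((uniformOmegaRep h F ι₁ V Φ e dV hdV hdV0 ιV δ' r).prop413Data H).rhoAt t))
    (hsep : ∀ s t : ((uniformOmegaRep h F ι₁ V Φ e dV hdV hdV0 ιV δ' r).prop413Data H).AdmTriple,
      Nontrivial (((uniformOmegaRep h F ι₁ V Φ e dV hdV hdV0 ιV δ' r).prop413Data H).omegaAt s) →
      (∃ f : ((uniformOmegaRep h F ι₁ V Φ e dV hdV hdV0 ιV δ' r).prop413Data H).omegaAt s ≃ₗ[ℂ]
          ((uniformOmegaRep h F ι₁ V Φ e dV hdV hdV0 ιV δ' r).prop413Data H).omegaAt t,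
        ∀ (g : (sec42DataOf h isoOf F ι₁ V Φ).G) (v : ((uniformOmegaRep h F ι₁ V Φ e dV hdV hdV0 ιV δ' r).prop413Data H).omegaAt s),
          f ((((uniformOmegaRep h F ι₁ V Φ e dV hdV hdV0 ιV δ' r).prop413Data H).rhoAt s) g v) =
            (((uniformOmegaRep h F ι₁ V Φ e dV hdV hdV0 ιV δ' r).prop413Data H).rhoAt t) g (f v)) → s = t)
    (hK : ∃ K : Subgroup (sec42DataOf h isoOf F ι₁ V Φ).G, IsOpenCompact K)
    (μ : IdeleClassGroup F →ₜ* Circle) (hμ : IdeleClassGroup.IsConjugateSymplectic F μ) (hw : IdeleClassGroup.HasWeight F μ 1)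
    (i : (toThm418Data (sec42DataOf h isoOf F ι₁ V Φ) (restOfCharRep h F h6 ι₁ V Φ e dV hdV hdV0 ιV δ' (r μ hμ) μ hμ hw)).AdmIndex) :
    Module.rank ℂ (Representation.IntertwiningMap
      ((toThm418Data (sec42DataOf h isoOf F ι₁ V Φ) (restOfCharRep h F h6 ι₁ V Φ e dV hdV hdV0 ιV δ' (r μ hμ) μ hμ hw)).rhoAt i)
      (Representation.ofModule' (k := ℂ) (G := (sec42DataOf h isoOf F ι₁ V Φ).G) H)) ≤ 1 :=
  (uniformOmegaRep h F ι₁ V Φ e dV hdV hdV0 ιV δ' r).rank_intertwiningMap_rhoAt_restOne_le_one_of_prop413AsPrinted (AlgHom.id ℚ F) ι₁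
    hμ hw (Def45.Carriers.ofPolDR μ (Def45.PolDR ι₁ hμ (Def45.RMuForm ι₁ hμ))) H h413 hn τ' h411 hsep hK _ i

end Frame

end Summit.HodgeConjecture.CorCM.Model

end
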